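import Summits.AtomisticToContinuum.FouriersLaw.Theorems.VanishingNoiseTransferNoiseLocalityStubResponseDensityNoisyDyson6
import Summits.AtomisticToContinuum.FouriersLaw.Theorems.VanishingNoiseTransferNoiseLocalityStubResponseDensityNoisyDyson7
import Summits.AtomisticToContinuum.FouriersLaw.Theorems.BondHeatUncertaintySubdiffusiveBondHeatKernelGibbsE
import Mathlib.MeasureTheory.Function.L2Space

/-!
# Flip-noisy response density, step 10: the equilibrium response density
(helpers for stub `stub_responseDensityNoisy`)

Helper file `--supports stmt-AtomisticToContinuum-11975` (crux `NoiseLocality`, route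
`VanishingNoiseTransfer`, line `relative-flip-energy-transfer`, stub 1b `stub_responseDensityNoisy`),
namespace `…NoiseLocality.StubResponseDensityNoisy.Dyson`.

Both baths at `T`; `R = R_r`, `K = Q ∘ₖ R` the equilibrium resolvent kernel and embedded flip chain,
`π_T` the Gibbs measure, `g = p_0² - p_{N-1}²`, `Θ(q,p) = (q,-p)`.

* `gibbsMeasure_bind_resolventKernel`, `gibbsMeasure_invariant_embeddedFlipKernel` — `π_T R = π_T`
  (Gibbs invariance of the transition kernels, `pinnedChain_gibbsMeasure_bind_transitionKernel`,
  averaged over the exponential time) and `π_T K = π_T` (`π_T Q = π_T`);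
* `exists_responseDensity` — **the equilibrium response functional has an explicit weighted density**:
  there is `h` with `|h| ≤ C_h e^{ϑH}`, `h ∈ L²(π_T)`, such that for every continuous `φ` with
  `|φ| ≤ C e^{ϑH}`: `(γ/2T²) r⁻¹ ∑ₙ π_T(g · Kⁿ R φ) = π_T(φ h)`; indeed
  `h = (γ/2T²) r⁻¹ (∑ₙ Kⁿ R g) ∘ Θ`, the Neumann series converging because `π_T(R g) = π_T(g) = 0`
  (the palindrome duality of `…Dyson6` termwise, and the Poisson bounds of `…Dyson7` with `π = π_T`).

No definitions.
-/

noncomputable section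

open MeasureTheory ProbabilityTheory Filter Topology Set
open scoped NNReal ENNReal

namespace Summit.AtomisticToContinuum.FouriersLaw.Theorems.NoiseLocality.StubResponseDensityNoisy.Dyson

open Literature.MathematicalPhysics.KineticTheory.HeatConduction
open Literature.Probability.Process Literature.MathematicalPhysics.KineticTheory OscillatorChain
open Summit.AtomisticToContinuum.FouriersLaw.Theorems.SubdiffusiveBondHeat

variable {N : ℕ}

section Equilibrium

variable {ω₂ lam β γ : ℝ} (hω : 0 < ω₂) (hl : 0 < lam) (hβ : 0 < β) (hγ : 0 < γ) (hN : 0 < N)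
  {T : ℝ} (hT : 0 < T) {ϑ : ℝ} (hϑ : 0 < ϑ) (h2ϑT : 2 * ϑ < 1 / (2 * T)) {r : ℝ} (hr : 0 < r)
include hω hl hβ hγ hN hT hϑ h2ϑT hr

omit hϑ h2ϑT in
/-- **The Gibbs measure is invariant for the equilibrium resolvent kernel**: `π_T R_r = π_T`. -/
theorem gibbsMeasure_bind_resolventKernel :
    ((pinnedChain ω₂ lam β γ).gibbsMeasure N T).bind
        ((pinnedChainSemigroup hω hl.le hβ.le hγ.le hN hT.le hT.le).resolventKernel r) =
      (pinnedChain ω₂ lam β γ).gibbsMeasure N T := by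
  set Sg := pinnedChainSemigroup hω hl.le hβ.le hγ.le hN hT.le hT.le with hSg
  haveI := isProbabilityMeasure_expMeasure hr
  haveI := pinnedChain_isProbabilityMeasure_gibbsMeasure hω hl.le hβ.le γ N hT
  refine Measure.ext fun A hA => ?_
  have happ : ∀ z, (Sg.resolventKernel r) z A =
      ∫⁻ t, (pinnedChain ω₂ lam β γ).transitionKernel N T T t.toNNReal z A ∂(expMeasure r) := fun z =>
    Sg.resolventKernel_apply hr z hA
  rw [Measure.bind_apply hA (Kernel.aemeasurable _)]
  simp_rw [happ]
  have hmeas0 : Measurable fun p : PhaseSpace N × ℝ => Sg.timeKernel (p.2, p.1) A :=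
    (Kernel.measurable_coe Sg.timeKernel hA).comp (measurable_snd.prodMk measurable_fst)
  have hmeas : Measurable fun p : PhaseSpace N × ℝ =>
      (pinnedChain ω₂ lam β γ).transitionKernel N T T p.2.toNNReal p.1 A := by
    simpa only [LangevinChainSemigroup.timeKernel_apply, hSg, pinnedChainSemigroup_kernel] using hmeas0
  rw [lintegral_lintegral_swap hmeas.aemeasurable]
  have hinv : ∀ t : ℝ, ∫⁻ z, (pinnedChain ω₂ lam β γ).transitionKernel N T T t.toNNReal z A
      ∂((pinnedChain ω₂ lam β γ).gibbsMeasure N T) = (pinnedChain ω₂ lam β γ).gibbsMeasure N T A := fun t => by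
    rw [← Measure.bind_apply hA (Kernel.aemeasurable _),
      pinnedChain_gibbsMeasure_bind_transitionKernel hω hl.le hβ.le hγ.le hN hT]
  simp_rw [hinv]
  rw [lintegral_const, measure_univ, mul_one]

omit hϑ h2ϑT in
/-- **The Gibbs measure is invariant for the equilibrium embedded flip chain**: `π_T K = π_T`. -/
theorem gibbsMeasure_invariant_embeddedFlipKernel :
    Kernel.Invariant ((pinnedChainSemigroup hω hl.le hβ.le hγ.le hN hT.le hT.le).embeddedFlipKernel r)
      ((pinnedChain ω₂ lam β γ).gibbsMeasure N T) := by
  show ((pinnedChain ω₂ lam β γ).gibbsMeasure N T).bind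
      ((pinnedChainSemigroup hω hl.le hβ.le hγ.le hN hT.le hT.le).embeddedFlipKernel r) = _
  rw [LangevinChainSemigroup.embeddedFlipKernel_eq, ← Measure.comp_assoc,
    show ((pinnedChainSemigroup hω hl.le hβ.le hγ.le hN hT.le hT.le).resolventKernel r) ∘ₘ
      ((pinnedChain ω₂ lam β γ).gibbsMeasure N T) = (pinnedChain ω₂ lam β γ).gibbsMeasure N T from
      gibbsMeasure_bind_resolventKernel hω hl hβ hγ hN hT hr]
  exact gibbsMeasure_bind_flipKernel _ N T

set_option maxHeartbeats 1600000 in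
/-- **The equilibrium response functional has a weighted `L²(π_T)` density.** Both baths at `T`;
there is `h` with `|h| ≤ C_h e^{ϑH}` and `h ∈ L²(π_T)` such that for every continuous `φ` with
`|φ| ≤ C e^{ϑH}` (`C ≥ 0`): `(γ/2T²) r⁻¹ ∑ₙ π_T(g · Kⁿ R φ) = π_T(φ h)` (`g = p_0² - p_{N-1}²`).
Here `h = (γ/2T²) r⁻¹ (∑ₙ Kⁿ R g) ∘ Θ`: the palindrome duality termwise; the series converges by the
Harris bounds with `π = π_T`, since `π_T(R g) = π_T(g) = 0`. -/
theorem exists_responseDensity :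
    ∃ h : PhaseSpace N → ℝ,
      (∃ Ch : ℝ, ∀ x, |h x| ≤ Ch * Real.exp (ϑ * (pinnedChain ω₂ lam β γ).hamiltonian N x)) ∧
      MemLp h 2 ((pinnedChain ω₂ lam β γ).gibbsMeasure N T) ∧
      ∀ {φ : PhaseSpace N → ℝ}, Continuous φ → ∀ {C : ℝ}, 0 ≤ C →
        (∀ y, |φ y| ≤ C * Real.exp (ϑ * (pinnedChain ω₂ lam β γ).hamiltonian N y)) →
        (γ / (2 * T ^ 2)) * r⁻¹ * ∑' n : ℕ, ∫ x, (x.2 ⟨0, hN⟩ ^ 2 - x.2 ⟨N - 1, by omega⟩ ^ 2) *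
            (∫ y, (∫ z, φ z ∂((pinnedChainSemigroup hω hl.le hβ.le hγ.le hN hT.le hT.le).resolventKernel r y))
              ∂((((pinnedChainSemigroup hω hl.le hβ.le hγ.le hN hT.le hT.le).embeddedFlipKernel r) ^ n) x))
            ∂((pinnedChain ω₂ lam β γ).gibbsMeasure N T) =
          ∫ x, φ x * h x ∂((pinnedChain ω₂ lam β γ).gibbsMeasure N T) := by
  have hHc : Continuous ((pinnedChain ω₂ lam β γ).hamiltonian N) := pinnedChain_continuous_hamiltonian ω₂ lam β γ N
  haveI := pinnedChain_isProbabilityMeasure_gibbsMeasure hω hl.le hβ.le γ N hT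
  set Sg := pinnedChainSemigroup hω hl.le hβ.le hγ.le hN hT.le hT.le with hSg
  set R0 := Sg.resolventKernel r with hR0
  set K0 := Sg.embeddedFlipKernel r with hK0
  haveI : IsMarkovKernel R0 := Sg.isMarkovKernel_resolventKernel hr
  haveI : IsMarkovKernel K0 := Sg.isMarkovKernel_embeddedFlipKernel hr
  haveI : ∀ m : ℕ, IsMarkovKernel (K0 ^ m) := fun m => Harris.isMarkovKernel_pow _ m
  have hW1 : ∀ x, (1 : ℝ) ≤ Real.exp (ϑ * (pinnedChain ω₂ lam β γ).hamiltonian N x) := fun x =>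
    Real.one_le_exp (mul_nonneg hϑ.le (pinnedChain_hamiltonian_nonneg hω.le hl.le hβ.le γ N x))
  have hΘc : Continuous fun x : PhaseSpace N => (x.1, -x.2) := continuous_fst.prodMk continuous_snd.neg
  -- `g`, its weighted bound, evenness
  set g : PhaseSpace N → ℝ := fun x => x.2 ⟨0, hN⟩ ^ 2 - x.2 ⟨N - 1, by omega⟩ ^ 2 with hg
  have hgc : Continuous g := by rw [hg]; fun_prop
  set Mg : ℝ := 4 / ϑ with hMg
  have hMg0 : 0 ≤ Mg := by positivity
  have hgb : ∀ y, |g y| ≤ Mg * Real.exp (ϑ * (pinnedChain ω₂ lam β γ).hamiltonian N y) := by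
    intro y
    have h1 := abs_sq_momentum_sub_le_exp (γ := γ) (T := 0) hω hl.le hβ.le hϑ le_rfl y ⟨0, hN⟩
    have h2 := abs_sq_momentum_sub_le_exp (γ := γ) (T := 0) hω hl.le hβ.le hϑ le_rfl y ⟨N - 1, by omega⟩
    rw [sub_zero, add_zero] at h1 h2
    rw [hg, hMg]; dsimp only
    calc |y.2 ⟨0, hN⟩ ^ 2 - y.2 ⟨N - 1, by omega⟩ ^ 2| ≤ |y.2 ⟨0, hN⟩ ^ 2| + |y.2 ⟨N - 1, by omega⟩ ^ 2| := abs_sub _ _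
      _ ≤ _ := by rw [show 4 / ϑ * Real.exp (ϑ * (pinnedChain ω₂ lam β γ).hamiltonian N y) =
          2 / ϑ * Real.exp (ϑ * (pinnedChain ω₂ lam β γ).hamiltonian N y) +
            2 / ϑ * Real.exp (ϑ * (pinnedChain ω₂ lam β γ).hamiltonian N y) by ring]; exact add_le_add h1 h2
  have hgeven : ∀ z : PhaseSpace N, g (z.1, -z.2) = g z := fun z => by simp [hg]
  -- toolkit and `ψ = R g`
  obtain ⟨CR, Cp, hCR, hCp, htk⟩ := equilibrium_toolkit hω hl hβ hγ hN hT hϑ h2ϑT hr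
  obtain ⟨⟨hgRI, hψc, hψb⟩, -⟩ := htk hgc hMg0 hgb
  set ψ : PhaseSpace N → ℝ := fun y => ∫ z, g z ∂(R0 y) with hψ
  have hψb' : ∀ y, |ψ y| ≤ Mg * CR * Real.exp (ϑ * (pinnedChain ω₂ lam β γ).hamiltonian N y) := hψb
  have hM : 0 ≤ Mg * CR := by positivity
  -- `π_T` is `K`-invariant; `π_T(ψ) = π_T(g) = 0`
  have hinvT := gibbsMeasure_invariant_embeddedFlipKernel hω hl hβ hγ hN hT hr
  have hbindR := gibbsMeasure_bind_resolventKernel hω hl hβ hγ hN hT hr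
  have hg0 : ∫ x, g x ∂((pinnedChain ω₂ lam β γ).gibbsMeasure N T) = 0 := integral_gibbs_oddMoment hω hl hβ hγ hN hT
  have hψ0 : ∫ y, ψ y ∂((pinnedChain ω₂ lam β γ).gibbsMeasure N T) = 0 := by
    have hgint : Integrable g (((pinnedChain ω₂ lam β γ).gibbsMeasure N T).bind R0) := by
      rw [hbindR]
      exact integrable_gibbs_of_abs_le hω hl hβ hT h2ϑT hgc (C := Mg) fun y => (hgb y).trans
        (mul_le_mul_of_nonneg_left (Real.exp_le_exp.2 (by
          nlinarith [pinnedChain_hamiltonian_nonneg hω.le hl.le hβ.le γ N y])) hMg0)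
    have h := Harris.integral_comp_measure R0 ((pinnedChain ω₂ lam β γ).gibbsMeasure N T) hgint
    rw [← h]
    change ∫ y, g y ∂(((pinnedChain ω₂ lam β γ).gibbsMeasure N T).bind R0) = 0
    rw [hbindR, hg0]
  -- Harris / Poisson bounds with `π = π_T`
  obtain ⟨abar, Cπ, Cg, h0, h1, -, hCg, hP⟩ := poisson_embeddedFlipKernel hω hl hβ hγ hN hT hϑ h2ϑT hr
  have hT2 : T / 2 ≤ T := by linarith
  have hT2' : T ≤ 2 * T := by linarith
  have hinvT' : Kernel.Invariant ((pinnedChainSemigroup hω hl.le hβ.le hγ.le hN ((half_pos hT).le.trans hT2)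
      ((half_pos hT).le.trans hT2)).embeddedFlipKernel r) ((pinnedChain ω₂ lam β γ).gibbsMeasure N T) := hinvT
  obtain ⟨-, hPψ⟩ := hP T T hT2 hT2' hT2 hT2' _ inferInstance hinvT'
  obtain ⟨hgeo0, -, hχc0, hχb0, -⟩ := hPψ ψ hψc (Mg * CR) hM hψb'
  set χ : PhaseSpace N → ℝ := fun x => ∑' n : ℕ, ((∫ y, ψ y ∂((K0 ^ n) x)) - ∫ y, ψ y ∂((pinnedChain ω₂ lam β γ).gibbsMeasure N T)) with hχ
  have hgeo : ∀ (n : ℕ) (x : PhaseSpace N), |(∫ y, ψ y ∂((K0 ^ n) x)) - ∫ y, ψ y ∂((pinnedChain ω₂ lam β γ).gibbsMeasure N T)| ≤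
      Cg * abar ^ n * (Mg * CR) * Real.exp (ϑ * (pinnedChain ω₂ lam β γ).hamiltonian N x) := hgeo0
  have hχc : Continuous χ := hχc0
  have hχb : ∀ y, |χ y| ≤ Cg / (1 - abar) * (Mg * CR) * Real.exp (ϑ * (pinnedChain ω₂ lam β γ).hamiltonian N y) := hχb0
  clear hgeo0 hχc0 hχb0 hPψ hP
  have h1a : 0 < 1 - abar := by linarith
  have hCχ : 0 ≤ Cg / (1 - abar) * (Mg * CR) := by positivity
  -- the density
  set c : ℝ := γ / (2 * T ^ 2) * r⁻¹ with hc
  refine ⟨fun x => c * χ (x.1, -x.2), ⟨|c| * (Cg / (1 - abar) * (Mg * CR)), fun x => ?_⟩, ?_, fun {φ} hφ {C} hC hφb => ?_⟩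
  · rw [abs_mul]
    have h := hχb (x.1, -x.2)
    rw [OscillatorChain.hamiltonian_neg_momentum] at h
    calc |c| * |χ (x.1, -x.2)| ≤ |c| * (Cg / (1 - abar) * (Mg * CR) * Real.exp (ϑ * (pinnedChain ω₂ lam β γ).hamiltonian N x)) :=
          mul_le_mul_of_nonneg_left h (abs_nonneg _)
      _ = _ := by ring
  · -- `h ∈ L²(π_T)`
    have hhc : Continuous fun x : PhaseSpace N => c * χ (x.1, -x.2) := continuous_const.mul (hχc.comp hΘc)
    refine (memLp_two_iff_integrable_sq hhc.aestronglyMeasurable).2 ?_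
    refine integrable_gibbs_of_abs_le hω hl hβ hT h2ϑT (hhc.pow 2) (C := (|c| * (Cg / (1 - abar) * (Mg * CR))) ^ 2)
      fun y => ?_
    have h := hχb (y.1, -y.2)
    rw [OscillatorChain.hamiltonian_neg_momentum] at h
    rw [abs_pow, abs_mul, show 2 * ϑ * (pinnedChain ω₂ lam β γ).hamiltonian N y =
      ϑ * (pinnedChain ω₂ lam β γ).hamiltonian N y + ϑ * (pinnedChain ω₂ lam β γ).hamiltonian N y by ring, Real.exp_add]
    have hab : |c| * |χ (y.1, -y.2)| ≤ |c| * (Cg / (1 - abar) * (Mg * CR)) * Real.exp (ϑ * (pinnedChain ω₂ lam β γ).hamiltonian N y) := by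
      calc |c| * |χ (y.1, -y.2)| ≤ |c| * (Cg / (1 - abar) * (Mg * CR) * Real.exp (ϑ * (pinnedChain ω₂ lam β γ).hamiltonian N y)) :=
            mul_le_mul_of_nonneg_left h (abs_nonneg _)
        _ = _ := by ring
    have h0' : 0 ≤ |c| * |χ (y.1, -y.2)| := by positivity
    calc (|c| * |χ (y.1, -y.2)|) ^ 2 ≤ (|c| * (Cg / (1 - abar) * (Mg * CR)) * Real.exp (ϑ * (pinnedChain ω₂ lam β γ).hamiltonian N y)) ^ 2 :=
          pow_le_pow_left₀ h0' hab 2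
      _ = _ := by ring
  · -- the identity: palindrome termwise, then `∫ ∑ = ∑ ∫`
    have hpal : ∀ n : ℕ, ∫ x, g x * (∫ y, (∫ z, φ z ∂(R0 y)) ∂((K0 ^ n) x)) ∂((pinnedChain ω₂ lam β γ).gibbsMeasure N T) =
        ∫ x, (∫ y, ψ y ∂((K0 ^ n) (x.1, -x.2))) * φ x ∂((pinnedChain ω₂ lam β γ).gibbsMeasure N T) := by
      intro n
      have h := integral_gibbs_mul_pow_resolvent_dual hω hl hβ hγ hN hT hϑ h2ϑT hr n hφ hgc hφb hgb
      simp_rw [hgeven] at h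
      exact h
    -- centring (`π_T(ψ) = 0`) and the termwise bound
    have hcen : ∀ (n : ℕ) (x : PhaseSpace N), ∫ y, ψ y ∂((K0 ^ n) x) =
        (∫ y, ψ y ∂((K0 ^ n) x)) - ∫ y, ψ y ∂((pinnedChain ω₂ lam β γ).gibbsMeasure N T) := fun n x => by rw [hψ0, sub_zero]
    have hI2 : Integrable (fun x => Real.exp (2 * ϑ * (pinnedChain ω₂ lam β γ).hamiltonian N x)) ((pinnedChain ω₂ lam β γ).gibbsMeasure N T) :=
      integrable_gibbs_of_abs_le hω hl hβ hT h2ϑT (Real.continuous_exp.comp (continuous_const.mul hHc)) (C := 1)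
        fun y => by rw [abs_of_pos (Real.exp_pos _), one_mul]
    have hfc : ∀ n : ℕ, Continuous fun x => φ x * ((∫ y, ψ y ∂((K0 ^ n) (x.1, -x.2))) - ∫ y, ψ y ∂((pinnedChain ω₂ lam β γ).gibbsMeasure N T)) := by
      intro n
      obtain ⟨-, hKc, -⟩ := (htk hψc hM hψb').2 n
      exact hφ.mul ((hKc.comp hΘc).sub continuous_const)
    have hfb : ∀ (n : ℕ) (x : PhaseSpace N), |φ x * ((∫ y, ψ y ∂((K0 ^ n) (x.1, -x.2))) - ∫ y, ψ y ∂((pinnedChain ω₂ lam β γ).gibbsMeasure N T))| ≤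
        C * (Cg * (Mg * CR)) * abar ^ n * Real.exp (2 * ϑ * (pinnedChain ω₂ lam β γ).hamiltonian N x) := by
      intro n x
      have h := hgeo n (x.1, -x.2)
      rw [OscillatorChain.hamiltonian_neg_momentum] at h
      rw [abs_mul, show 2 * ϑ * (pinnedChain ω₂ lam β γ).hamiltonian N x =
        ϑ * (pinnedChain ω₂ lam β γ).hamiltonian N x + ϑ * (pinnedChain ω₂ lam β γ).hamiltonian N x by ring, Real.exp_add]
      calc |φ x| * |(∫ y, ψ y ∂((K0 ^ n) (x.1, -x.2))) - ∫ y, ψ y ∂((pinnedChain ω₂ lam β γ).gibbsMeasure N T)|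
          ≤ C * Real.exp (ϑ * (pinnedChain ω₂ lam β γ).hamiltonian N x) *
            (Cg * abar ^ n * (Mg * CR) * Real.exp (ϑ * (pinnedChain ω₂ lam β γ).hamiltonian N x)) :=
            mul_le_mul (hφb x) h (abs_nonneg _) (by positivity)
        _ = _ := by ring
    have hfI : ∀ n : ℕ, Integrable (fun x => φ x * ((∫ y, ψ y ∂((K0 ^ n) (x.1, -x.2))) - ∫ y, ψ y ∂((pinnedChain ω₂ lam β γ).gibbsMeasure N T)))
        ((pinnedChain ω₂ lam β γ).gibbsMeasure N T) := fun n =>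
      (hI2.const_mul (C * (Cg * (Mg * CR)) * abar ^ n)).mono' (hfc n).aestronglyMeasurable
        (Eventually.of_forall fun x => by rw [Real.norm_eq_abs]; exact hfb n x)
    have hseries : ∑' n : ℕ, ∫ x, (∫ y, ψ y ∂((K0 ^ n) (x.1, -x.2))) * φ x ∂((pinnedChain ω₂ lam β γ).gibbsMeasure N T) =
        ∫ x, φ x * χ (x.1, -x.2) ∂((pinnedChain ω₂ lam β γ).gibbsMeasure N T) := by
      have e1 : ∀ n : ℕ, ∫ x, (∫ y, ψ y ∂((K0 ^ n) (x.1, -x.2))) * φ x ∂((pinnedChain ω₂ lam β γ).gibbsMeasure N T) =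
          ∫ x, φ x * ((∫ y, ψ y ∂((K0 ^ n) (x.1, -x.2))) - ∫ y, ψ y ∂((pinnedChain ω₂ lam β γ).gibbsMeasure N T))
            ∂((pinnedChain ω₂ lam β γ).gibbsMeasure N T) := fun n => by
        congr 1; funext x; rw [← hcen n (x.1, -x.2)]; ring
      simp_rw [e1]
      have e2 : ∀ x : PhaseSpace N, φ x * χ (x.1, -x.2) =
          ∑' n : ℕ, φ x * ((∫ y, ψ y ∂((K0 ^ n) (x.1, -x.2))) - ∫ y, ψ y ∂((pinnedChain ω₂ lam β γ).gibbsMeasure N T)) := fun x => by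
        rw [hχ]; exact (tsum_mul_left).symm
      simp_rw [e2]
      refine (integral_tsum (fun n => (hfc n).aestronglyMeasurable) ?_).symm
      have hL1 : ∀ n : ℕ, ∫⁻ x, ‖φ x * ((∫ y, ψ y ∂((K0 ^ n) (x.1, -x.2))) - ∫ y, ψ y ∂((pinnedChain ω₂ lam β γ).gibbsMeasure N T))‖ₑ
          ∂((pinnedChain ω₂ lam β γ).gibbsMeasure N T) ≤ ENNReal.ofReal (C * (Cg * (Mg * CR)) * abar ^ n *
            ∫ x, Real.exp (2 * ϑ * (pinnedChain ω₂ lam β γ).hamiltonian N x) ∂((pinnedChain ω₂ lam β γ).gibbsMeasure N T)) := by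
        intro n
        rw [← ofReal_integral_norm_eq_lintegral_enorm (hfI n), ← integral_const_mul]
        refine ENNReal.ofReal_le_ofReal (integral_mono (hfI n).norm (hI2.const_mul _) fun x => ?_)
        rw [Real.norm_eq_abs]; exact hfb n x
      refine ne_top_of_le_ne_top ?_ (ENNReal.tsum_le_tsum hL1)
      have hI20 : 0 ≤ ∫ x, Real.exp (2 * ϑ * (pinnedChain ω₂ lam β γ).hamiltonian N x) ∂((pinnedChain ω₂ lam β γ).gibbsMeasure N T) :=
        integral_nonneg fun x => (Real.exp_pos _).le
      have hsumI : Summable fun n : ℕ => C * (Cg * (Mg * CR)) * abar ^ n *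
          ∫ x, Real.exp (2 * ϑ * (pinnedChain ω₂ lam β γ).hamiltonian N x) ∂((pinnedChain ω₂ lam β γ).gibbsMeasure N T) :=
        ((summable_geometric_of_lt_one h0.le h1).mul_left (C * (Cg * (Mg * CR)) *
          ∫ x, Real.exp (2 * ϑ * (pinnedChain ω₂ lam β γ).hamiltonian N x) ∂((pinnedChain ω₂ lam β γ).gibbsMeasure N T))).congr fun n => by ring
      rw [← ENNReal.ofReal_tsum_of_nonneg (fun n => mul_nonneg (mul_nonneg (mul_nonneg hC (mul_nonneg hCg hM)) (pow_nonneg h0.le n)) hI20) hsumI]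
      exact ENNReal.ofReal_ne_top
    show c * ∑' n : ℕ, ∫ x, g x * (∫ y, (∫ z, φ z ∂(R0 y)) ∂((K0 ^ n) x)) ∂((pinnedChain ω₂ lam β γ).gibbsMeasure N T) =
      ∫ x, φ x * (c * χ (x.1, -x.2)) ∂((pinnedChain ω₂ lam β γ).gibbsMeasure N T)
    simp_rw [hpal]
    rw [hseries, ← integral_const_mul]
    exact integral_congr_ae (Eventually.of_forall fun x => by ring)

end Equilibrium

/-- Registered helper sub-goal `helper_responseDensityNoisyDysonDensity` of stmt-AtomisticToContinuum-11975
(fully quantified, notation-free one-line form of the main theorem of this file). -/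
theorem helper_responseDensityNoisyDysonDensity : ∀ (ω₂ lam β γ : ℝ) (hω : 0 < ω₂) (hl : 0 < lam) (hβ : 0 < β) (hγ : 0 < γ) (N : ℕ) (hN : 0 < N) (T : ℝ) (hT : 0 < T) (ϑ : ℝ) (hϑ : 0 < ϑ) (h2ϑT : 2 * ϑ < 1 / (2 * T)) (r : ℝ) (hr : 0 < r), ∃ h : Literature.MathematicalPhysics.KineticTheory.HeatConduction.PhaseSpace N → ℝ, (∃ Ch : ℝ, ∀ x, |h x| ≤ Ch * Real.exp (ϑ * (Literature.MathematicalPhysics.KineticTheory.HeatConduction.pinnedChain ω₂ lam β γ).hamiltonian N x)) ∧ MeasureTheory.MemLp h 2 ((Literature.MathematicalPhysics.KineticTheory.HeatConduction.pinnedChain ω₂ lam β γ).gibbsMeasure N T) ∧ ∀ {φ : Literature.MathematicalPhysics.KineticTheory.HeatConduction.PhaseSpace N → ℝ}, Continuous φ → ∀ {C : ℝ}, 0 ≤ C → (∀ y, |φ y| ≤ C * Real.exp (ϑ * (Literature.MathematicalPhysics.KineticTheory.HeatConduction.pinnedChain ω₂ lam β γ).hamiltonian N y)) → (γ / (2 *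 T ^ 2)) * r⁻¹ * ∑' n : ℕ, ∫ x, (x.2 ⟨0, hN⟩ ^ 2 - x.2 ⟨N - 1, by omega⟩ ^ 2) * (∫ y, (∫ z, φ z ∂((Literature.MathematicalPhysics.KineticTheory.HeatConduction.pinnedChainSemigroup hω hl.le hβ.le hγ.le hN hT.le hT.le).resolventKernel r y)) ∂((((Literature.MathematicalPhysics.KineticTheory.HeatConduction.pinnedChainSemigroup hω hl.le hβ.le hγ.le hN hT.le hT.le).embeddedFlipKernel r) ^ n) x)) ∂((Literature.MathematicalPhysics.KineticTheory.HeatConduction.pinnedChain ω₂ lam β γ).gibbsMeasure N T) = ∫ x, φ x * h x ∂((Literature.MathematicalPhysics.KineticTheory.HeatConduction.pinnedChain ω₂ lam β γ).gibbsMeasure N T) :=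
  fun _ _ _ _ hω hl hβ hγ _ hN _ hT _ hϑ h2ϑT _ hr => exists_responseDensity hω hl hβ hγ hN hT hϑ h2ϑT hr

end Summit.AtomisticToContinuum.FouriersLaw.Theorems.NoiseLocality.StubResponseDensityNoisy.Dyson

end
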